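import Literature.Geometry.Riemannian.KarpukhinSternReduction
import HarnessLib

/-!
# Karpukhin–Stern, Cor. 1.3 with Thm. 1.5: decomposition into the three remaining printed inputs

Decomposition record (librarian, mode `fact-decompose`, 2026-08-16) for the XL named fact
`Literature.Geometry.Riemannian.karpukhinStern_groundStateHarmonicMap` (M. Karpukhin, D. Stern,
*Existence of harmonic maps and eigenvalue optimization in higher dimensions*, Invent. Math. 236
(2024) 713–778 = arXiv:2207.13635, Cor. 1.3 with Thm. 1.5: on every closed Riemannian
`n`-manifold, `3 ≤ n ≤ 5`, for all large `k` a nonconstant smooth harmonic map `u : M → Sᵏ` whose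
energy density `e = |du|²` has `λ₁(M, g, e) = 1`).

**Decision: SPLIT into three children (new named facts) + proved glue.** The fact's seat
formalised the 66-page proof down to exactly three printed inputs
(`KarpukhinStern.karpukhinStern_groundStateHarmonicMap_of_thm32_of_monotonicity_of_gap`,
`KarpukhinSternReduction`; the chain Lemma 3.6 ⇒ Lemma 3.7 ⇒ Prop. 3.8 ⇒ Thm. 4.6 and Lemma 3.6
itself from monotonicity, gap and volume growth being proved in `KarpukhinSternAssembly`,
`KarpukhinSternLemma36`, `KarpukhinSternBochner`, `KarpukhinSternStabilization(Limit)`,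
`KarpukhinSternHarmonicMapsProofs`). This file names those inputs, verbatim the three hypotheses
of that theorem, in the vocabulary of the fact (`KarpukhinStern.energyDensity`,
`KarpukhinStern.energyIndex`, smooth-section energy index of the tree):

* child 1 (new): `KarpukhinStern2024_thm32` — **Theorem 3.2** (p. 745): existence of the min–max
  harmonic maps `u_k : M → Sᵏ`, nonconstant, smooth for `3 ≤ n ≤ 5`, with `ind_E(u_k) ≤ k + 1`;
* child 2 (new): `KarpukhinStern2024_energyMonotonicity` — the **energy monotonicity inequality**
  for smooth harmonic maps into spheres on small geodesic balls (p. 751, proof of Lemma 3.6: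
  "`∫_{B_{2δ}(p)} |du|² ⩽ C(M) δ^{n−2} ∫_M |du|²` … by the well-known energy-monotonicity
  properties of stationary harmonic maps"; Price 1983 / Schoen 1984);
* child 3 (new): `KarpukhinStern2024_prop55_energyGap` — **Proposition 5.5** (p. 773): the energy
  gap `E(u) ≥ β(M, g) > 0` for nonconstant harmonic `u : M → Sᵏ`, `β` independent of `k`;
* glue (proved): `karpukhinStern_groundStateHarmonicMap_holds_of : child 1 → child 2 → child 3 →
  karpukhinStern_groundStateHarmonicMap`.

None of the children restates the parent (no eigenvalue/Rayleigh clause, no ground-state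
conclusion; child 1 is an existence theorem with an index bound, children 2–3 are a priori
estimates for arbitrary harmonic maps). Sizes: child 1 L–XL (min–max theory of §2 with the
regularity of §5), child 2 M (monotonicity formula for smooth harmonic maps: first variation of the
domain, Price's formula), child 3 M–L (Prop. 5.5: ε-regularity / Bochner on small energy).

## References

* M. Karpukhin, D. Stern, Invent. Math. 236 (2024) 713–778 = arXiv:2207.13635: Thm. 3.2 (p. 745),
  Lemma 3.6 and its proof (pp. 750–751), Prop. 5.5 (p. 773), Cor. 1.3, Thm. 1.5. [KarpukhinStern2024]
* P. Price, *A monotonicity formula for Yang–Mills fields*, Manuscripta Math. 43 (1983) 131–166;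
  R. Schoen, *Analytic aspects of the harmonic map problem*, MSRI Publ. 2 (1984), §2 (monotonicity).
-/

noncomputable section

open Manifold Bundle MeasureTheory Measure Set Filter Metric Module
open scoped ContDiff Topology ENNReal NNReal

namespace Literature.Geometry.Riemannian

open Lorentzian Lorentzian.PseudoRiemannianMetric KarpukhinStern

/-- **Karpukhin–Stern 2024, Theorem 3.2** (p. 745; the min–max harmonic maps of §2 with the
regularity of §5 for `3 ≤ n ≤ 5`), named fact, child 1 of the decomposition of
`karpukhinStern_groundStateHarmonicMap`: on every closed connected Riemannian `n`-manifold
`(M, g)`, `3 ≤ n ≤ 5`, there is `k₁` such that for every `k ≥ k₁` there is a nonconstant `C^∞`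
map `u : M → Sᵏ ⊂ ℝᵏ⁺¹` which is harmonic (`tr_g Hess uᵢ = −|du|²_g uᵢ` for every coordinate,
`KarpukhinStern.energyDensity`) with energy index `ind_E(u) ≤ k + 1` (`KarpukhinStern.energyIndex`,
the index of the second variation over smooth sections — at most the printed `W^{1,2}`-index, so
this is implied by the printed statement "there is a nonconstant stationary harmonic map
`u_k : Mⁿ → Sᵏ` of Morse index `ind_E(u_k) ⩽ k + 1` … if `3 ⩽ n ⩽ 5`, then `u_k` is smooth for
all `k ⩾ n`"). Verbatim the hypothesis `h32` of
`KarpukhinStern.karpukhinStern_groundStateHarmonicMap_of_thm32_of_monotonicity_of_gap`.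
[cite: KarpukhinStern2024, Thm. 3.2 (p. 745) with Cor. 1.3 (p. 716)] -/
def KarpukhinStern2024_thm32 : Prop :=
  ∀ (n : ℕ), 3 ≤ n → n ≤ 5 →
    ∀ (M : Type) [TopologicalSpace M] [T2Space M] [SecondCountableTopology M]
      [ChartedSpace (EuclideanSpace ℝ (Fin n)) M] [IsManifold (𝓡 n) ∞ M] [CompactSpace M]
      [ConnectedSpace M] [T3Space M] [MeasurableSpace M] [BorelSpace M]
      (g : Bundle.ContMDiffRiemannianMetric (𝓡 n) ∞ (EuclideanSpace ℝ (Fin n))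
        (TangentSpace (𝓡 n) : M → Type _))
      (_ : (ofRiemannian g).HasLeviCivita),
      ∃ k₁ : ℕ, ∀ k : ℕ, k₁ ≤ k →
        ∃ (u : M → Metric.sphere (0 : EuclideanSpace ℝ (Fin (k + 1))) 1)
          (hu : ContMDiff (𝓡 n) (𝓡 k) ∞ u),
          (∃ x y : M, u x ≠ u y) ∧
          (∀ (i : Fin (k + 1)) (x : M), (ofRiemannian g).dalembertian
            (fun y ↦ (u y : EuclideanSpace ℝ (Fin (k + 1))) i) x =
              -(energyDensity g u x) * (u x : EuclideanSpace ℝ (Fin (k + 1))) i) ∧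
          energyIndex g hu ≤ (k + 1 : ℕ)

/-- **Energy monotonicity for smooth harmonic maps into spheres on small geodesic balls**
(Karpukhin–Stern 2024, p. 751, proof of Lemma 3.6: "`∫_{B_{2δ}(p)} |du|² ⩽ C(M) δ^{n−2} ∫_M |du|²`
… by the well-known energy-monotonicity properties of stationary harmonic maps", i.e. Price's
monotonicity formula, Schoen 1984 §2), named fact, child 2 of the decomposition of
`karpukhinStern_groundStateHarmonicMap`: on every closed connected Riemannian `n`-manifold,
`3 ≤ n ≤ 5`, there are `C₁` and `δ₀ > 0` such that for every nonconstant smooth harmonic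
`u : M → Sᵏ` (any `k`), every point `p` and every `0 < δ ≤ δ₀`,
`∫_{B_{2δ}(p)} |du|²_g dv_g ≤ C₁ δ^{n-2} ∫_M |du|²_g dv_g` (geodesic balls of the length metric,
`(ofRiemannian g).ball`). Verbatim the hypothesis `hmono` of
`KarpukhinStern.karpukhinStern_groundStateHarmonicMap_of_thm32_of_monotonicity_of_gap`.
[cite: KarpukhinStern2024, proof of Lemma 3.6 (p. 751)] -/
def KarpukhinStern2024_energyMonotonicity : Prop :=
  ∀ (n : ℕ), 3 ≤ n → n ≤ 5 →
    ∀ (M : Type) [TopologicalSpace M] [T2Space M] [SecondCountableTopology M]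
      [ChartedSpace (EuclideanSpace ℝ (Fin n)) M] [IsManifold (𝓡 n) ∞ M] [CompactSpace M]
      [ConnectedSpace M] [T3Space M] [MeasurableSpace M] [BorelSpace M]
      (g : Bundle.ContMDiffRiemannianMetric (𝓡 n) ∞ (EuclideanSpace ℝ (Fin n))
        (TangentSpace (𝓡 n) : M → Type _))
      (_ : (ofRiemannian g).HasLeviCivita),
      ∃ C₁ δ₀ : ℝ, 0 < δ₀ ∧ ∀ {k : ℕ} (u : M → Metric.sphere (0 : EuclideanSpace ℝ (Fin (k + 1))) 1)
        (_hu : ContMDiff (𝓡 n) (𝓡 k) ∞ u),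
        (∀ (i : Fin (k + 1)) (x : M), (ofRiemannian g).dalembertian
          (fun y ↦ (u y : EuclideanSpace ℝ (Fin (k + 1))) i) x =
            -(energyDensity g u x) * (u x : EuclideanSpace ℝ (Fin (k + 1))) i) →
        (∃ x y : M, u x ≠ u y) → ∀ (p : M) (δ : ℝ), 0 < δ → δ ≤ δ₀ →
        ∫ x in (ofRiemannian g).ball p (ENNReal.ofReal (2 * δ)), energyDensity g u x
            ∂riemannianMeasure g ≤
          C₁ * δ ^ (n - 2) * ∫ x, energyDensity g u x ∂riemannianMeasure g

/-- **Karpukhin–Stern 2024, Proposition 5.5 (energy gap)** (p. 773: there is `β(M, g) > 0`, independent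
of `k`, with `E(u) ≥ β` for every nonconstant harmonic `u : M → Sᵏ`), named fact, child 3 of the
decomposition of `karpukhinStern_groundStateHarmonicMap`, for smooth harmonic maps on closed
connected Riemannian `n`-manifolds, `3 ≤ n ≤ 5`, with `E(u) = ∫_M |du|²_g dv_g`
(`KarpukhinStern.energyDensity`). Verbatim the hypothesis `hgap` of
`KarpukhinStern.karpukhinStern_groundStateHarmonicMap_of_thm32_of_monotonicity_of_gap`.
[cite: KarpukhinStern2024, Prop. 5.5 (p. 773)] -/
def KarpukhinStern2024_prop55_energyGap : Prop :=
  ∀ (n : ℕ), 3 ≤ n → n ≤ 5 →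
    ∀ (M : Type) [TopologicalSpace M] [T2Space M] [SecondCountableTopology M]
      [ChartedSpace (EuclideanSpace ℝ (Fin n)) M] [IsManifold (𝓡 n) ∞ M] [CompactSpace M]
      [ConnectedSpace M] [T3Space M] [MeasurableSpace M] [BorelSpace M]
      (g : Bundle.ContMDiffRiemannianMetric (𝓡 n) ∞ (EuclideanSpace ℝ (Fin n))
        (TangentSpace (𝓡 n) : M → Type _))
      (_ : (ofRiemannian g).HasLeviCivita),
      ∃ β : ℝ, 0 < β ∧ ∀ {k : ℕ} (u : M → Metric.sphere (0 : EuclideanSpace ℝ (Fin (k + 1))) 1)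
        (_hu : ContMDiff (𝓡 n) (𝓡 k) ∞ u),
        (∀ (i : Fin (k + 1)) (x : M), (ofRiemannian g).dalembertian
          (fun y ↦ (u y : EuclideanSpace ℝ (Fin (k + 1))) i) x =
            -(energyDensity g u x) * (u x : EuclideanSpace ℝ (Fin (k + 1))) i) →
        (∃ x y : M, u x ≠ u y) → β ≤ ∫ x, energyDensity g u x ∂riemannianMeasure g

/-- **Glue of the decomposition of `karpukhinStern_groundStateHarmonicMap`**: the named fact
(Karpukhin–Stern 2024, Cor. 1.3 with Thm. 1.5) follows from its three children — Thm. 3.2, the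
energy monotonicity inequality and the energy gap Prop. 5.5 — by the seat's proved reduction
`KarpukhinStern.karpukhinStern_groundStateHarmonicMap_of_thm32_of_monotonicity_of_gap` (Lemma 3.6
from monotonicity + gap + Euclidean volume growth of small balls; Lemma 3.7, Prop. 3.8 and the
Thm. 4.6 endgame). [cite: KarpukhinStern2024, Cor. 1.3, Thm. 1.5, Thm. 3.2, Lemma 3.6, Prop. 5.5] -/
theorem karpukhinStern_groundStateHarmonicMap_holds_of (h32 : KarpukhinStern2024_thm32)
    (hmono : KarpukhinStern2024_energyMonotonicity) (hgap : KarpukhinStern2024_prop55_energyGap) :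
    karpukhinStern_groundStateHarmonicMap :=
  karpukhinStern_groundStateHarmonicMap_of_thm32_of_monotonicity_of_gap h32 hmono hgap

end Literature.Geometry.Riemannian

end
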